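import Summits.QuantumFields.YangMills.Theorems.BalabanUVNodesN15KingModelBoxFoldedSpectrum
import Summits.QuantumFields.YangMills.Theorems.BalabanUVNodesN15KingModelBoxBlockFieldLaw
import Summits.QuantumFields.YangMills.Theorems.BalabanUVNodesN15KingModelGaussNormDeterminant
import HarnessLib

/-!
# BalabanUVNodes ∕ N15 — THE KING-MODEL RUNG (PART Ϟ-c): THE DETERMINANTS AND NORMALISATIONS OF KING's FREE-BOUNDARY OPERATORS ON HIS REGION `Ω` —
# `det(c(−Δ_free)+m²)_Ω = Π_{k∈Ω}(m² + cΣ_μ(2−2cos(πk_μ∕n_μ)))`, the Neumann Green's function and NE2's unit-layer kernel `(Δ^{(K)}_Ω)⁻¹` IN THE COSINE BASIS,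
# `det Δ^{(K)}_Ω = Π_{k∈Ω} effSym(k̂)`, and KING's (3.89) ON `Ω` LITERALLY: `ln N_K(Ω) = ½|Ω|ln 2π − ½Σ_{k∈Ω} ln effSym(k̂)`
# (Track A, DAG node N15 = NE2; FAN-OUT v1.1 §N15 s3 «KING-MODEL RUNG»; King p.670 l.8–13 «free boundary conditions»; count-neutral)

HONEST FRAMING.  Count-neutral (cell `pub-ymgap`, seat `pub-ymgap-dag-n15-e` g41; `--supports stmt-QuantumFields-27366 --as helper` = K3⁸).
TEMPLATE LITERATURE: C. King, Commun. Math. Phys. **102** (1986) 649–677 [King1986]: §4 p.670 l.8–13 (on a rectangular parallelepiped `Ω` the propagators are those of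
«the operator defined by (2.13) with free boundary conditions (and `A = 0`, of course)»), (2.6) p.652 and (3.89)–(3.93) pp.668–669 (the Gaussian normalisations `N_k` of the
effective actions, `ln N_k = −½ln det`), (2.14) p.653 (`Δ^{(k)}`), (4.4)–(4.5) p.670 (symbols).  Parts Ε-k∕Ε-n∕Ε-p (g40) gave the TORUS determinants `det lapF = Π_q lapSym(q)`,
`det Δ^{(K)} = Π_q effSym(q)` and (3.89) on the torus; parts Ν (g39) the free-boundary operators on `Ω` (`boxOp = fold(lapF)`, `fold(Δ^{(K)})`, its law, NE2's unit layer on `Ω`);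
parts Ϟ-a∕Ϟ-b the cosine basis and `det fold(A) = Π_{k∈Ω}σ(k̂)`.  THIS FILE INSTANTIATES Ϟ-b at King's operators.
§0 (generic complements to Ϟ-a) `boxWaveMatrix_inv_eq` (`W⁻¹ = diag(weight)⁻¹Wᵀ`), ★★ `eq_mul_diagonal_mul_transpose_of_boxWave_eigen` (`B = W·diag(σ∕weight)·Wᵀ`), ★★ **`apply_eq_sum_boxWave_of_eigen`** (`B(s,t) = Σ_k σ_k w_k(s)w_k(t)∕weight_k`),
★★ **`inv_apply_eq_sum_boxWave_of_eigen`** (`B⁻¹(s,t) = Σ_k w_k(s)w_k(t)∕(σ_k·weight_k)`).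
§1 KING's `c(−Δ)+m²` WITH FREE BOUNDARY CONDITIONS: `lapF_eigen_chi`, `valMinAbs_dblBox`, ★ `sOf_dblBox` (the reduced momentum of `k̂` is `πk_μ∕n_μ`), ★ `lapSym_dblBox`,
★★★ **`boxOp_mulVec_boxWave`** (THE NEUMANN EIGEN-EQUATION `(c(−Δ_free)+m²)w_k = (m² + cΣ_μ(2−2cos(πk_μ∕n_μ)))w_k`, every real `c, m²`), ★★★ **`det_boxOp_eq_prod_lapSym`**,
★★ `det_boxOp_eq_prod_cos`, ★★ `trace_boxOp_eq_sum`, `det_boxOp_pos`, ★★ `log_det_boxOp`, ★★ `log_det_boxOp_bounds` (`|Ω|ln m² ≤ ln det ≤ |Ω|ln(m²+4c(d+1))` — the SAME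
volume-uniform bounds as on the torus), ★★ **`log_gaussNorm_boxOp`** (the free-field normalisation with free boundary conditions: `ln 𝒩 = ½|Ω|ln 2π − ½Σ_k ln lapSym(k̂)`),
`boxOp_inv_mulVec_boxWave`, ★★★ **`kingBoxGreen_eq_sum_boxWave`** (THE NEUMANN GREEN's FUNCTION OF `Ω` IN THE COSINE BASIS:
`G^Ω(s,t) = Σ_{k∈Ω} w_k(s)w_k(t)∕(weight_k·lapSym(k̂))` — a third closed form next to Ν-a′'s image sum and Ε-c's [Ba 4] (2.42) series).
§2 KING's RG BLOCK-FIELD OPERATOR ON `Ω`: ★★ `foldOp_effLaplacian_mulVec_boxWave`, ★★★ **`det_foldOp_effLaplacian_eq_prod`** (`det Δ^{(K)}_Ω = Π_{k∈Ω} effSym(k̂)`, every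
`N ≥ 1`, `a, c ≥ 0`, `m² > 0`), `det_foldOp_effLaplacian_pos`, ★★ `log_det_foldOp_effLaplacian`, ★★ `log_det_foldOp_effLaplacian_bounds` (`|Ω|ln(a∕(1+a∕m²)) ≤ … ≤ |Ω|ln a`),
★★★ **`log_gaussNorm_foldOp_effLaplacian`** (KING's (3.89) ON `Ω` LITERALLY: `ln N_K(Ω) = ½|Ω|ln 2π − ½Σ_{k∈Ω} ln effSym(k̂)`), ★★ `log_gaussNorm_foldOp_effLaplacian_bounds`,
★★★ **`foldOp_effLaplacian_inv_apply_eq_sum_boxWave`** (NE2's UNIT-LAYER KERNEL ON `Ω` IN THE COSINE BASIS: `(Δ^{(K)}_Ω)⁻¹(s,t) = Σ_k w_k(s)w_k(t)∕(weight_k·effSym(k̂))`).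

PRIOR TREE ART (named, USED not restated): Ϟ-a∕Ϟ-b (`boxWave`, `boxWaveWeight`, `boxWaveMatrix`, `foldOp_mulVec_boxWave`, `det_foldOp_eq_prod(_of_fourierForm)`,
`trace_foldOp_eq_sum`, `eigen_chi_of_fourierForm`), Ν-a∕Ν-a′∕Ν-d∕Ν-f∕Ν-g∕Ν-h (`boxOp`, `kingBoxGreen`, `boxOp_inv_eq_kingBoxGreen`, `boxOp_eq_foldOp`, `boxOp_coercive`,
`boxOp_transpose`, `isReflSymm_lapF`, `isReflSymm_effLaplacian`, `foldOp_effLaplacian_coercive`, `foldOp_transpose_eq`), Ε-e (`sum_lapF_mul_chi`, `lapSym_le`), Ε-n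
(`effSym_neg`, `effSym_bounds`, `effSym_pos'`), Ϡ-g (`effLaplacian_apply_eq_fourier`), Ε-p (`log_gaussNorm_eq`, `det_pos_of_coercive`), Τ-b (`gaussNorm`), `King1986`
(`lapF`, `lapSym`, `lapSym_ge`, `effLaplacian`, `effSym`, `effLaplacian_transpose_eq`).  NOT Bałaban's covariant objects; NOT a node discharge (N15 is booked through n15-a's
knit, untouched); nothing continuum-YM ∕ `ℝ⁴` ∕ OS ∕ Clay.  0 `sorry`; 0 `def`.

HONEST SCOPE.  King's `A = 0` free model on his region `Ω = Π_μ{0,…,n_μ−1}` (every `d`, all sides ≥ 1): finite-dimensional identities; the sign conditions are only those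
of the logarithms ∕ normalisations.  The `η`-RATE (3.93) of `ln N_K(Ω)` and the thermodynamic limit of `|Ω|⁻¹ln det` are NOT in this file (parts Ϟ-d∕Ϟ-e).  Locators:
[King1986] §4 p.670 l.8–13, (2.6) p.652, (2.13)–(2.14) p.653, (3.89)–(3.93) pp.668–669, (4.4)–(4.5) p.670, (4.35) p.674.
-/

noncomputable section

open scoped BigOperators
open Finset Matrix

namespace Summit.QuantumFields.YangMills.BalabanUVNodes.N15KingModelRung.TorusSpectral

open Literature.MathematicalPhysics.QuantumFieldTheory.Balaban1983to89.B5Prop11Plancherel (Tor chi sOf)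
open Literature.MathematicalPhysics.QuantumFieldTheory.Balaban1983to89.QGQInverse (Coercive)
open Literature.MathematicalPhysics.QuantumFieldTheory.King1986.Torus
open Summit.QuantumFields.YangMills.BalabanUVNodes.N15KingModelRung.FreeField (gaussNorm)

variable {d : ℕ}

/-! ## §0 Generic complements: spectral expansions in the cosine basis -/

section Generic

variable (n : Fin (d + 1) → ℕ) [hn : ∀ μ, NeZero (n μ)]

/-- `W⁻¹ = diag(weight)⁻¹·Wᵀ` (from `WᵀW = diag(weight)`). [folklore] -/
theorem boxWaveMatrix_inv_eq : (boxWaveMatrix n)⁻¹ = Matrix.diagonal (fun k => (boxWaveWeight n k)⁻¹) * (boxWaveMatrix n)ᵀ := by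
  refine Matrix.inv_eq_left_inv ?_
  rw [Matrix.mul_assoc, boxWaveMatrix_transpose_mul_self, Matrix.diagonal_mul_diagonal]
  rw [← Matrix.diagonal_one]
  congr 1
  funext k
  exact inv_mul_cancel₀ (boxWaveWeight_pos n k).ne'

/-- ★★ **DIAGONALISATION BY THE ORTHOGONAL COSINE MATRIX**: `B = W·diag(σ∕weight)·Wᵀ`. [folklore] -/
theorem eq_mul_diagonal_mul_transpose_of_boxWave_eigen (B : Matrix (KingBox n) (KingBox n) ℝ) (σ : KingBox n → ℝ) (hB : ∀ k, B *ᵥ boxWave n k = σ k • boxWave n k) :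
    B = boxWaveMatrix n * Matrix.diagonal (fun k => σ k * (boxWaveWeight n k)⁻¹) * (boxWaveMatrix n)ᵀ := by
  rw [eq_conj_diagonal_of_boxWave_eigen n B σ hB, boxWaveMatrix_inv_eq, ← Matrix.mul_assoc, Matrix.mul_assoc (boxWaveMatrix n), Matrix.diagonal_mul_diagonal]

/-- ★★ **SPECTRAL EXPANSION**: if every cosine wave is an eigenvector, `B(s,t) = Σ_k σ_k·w_k(s)w_k(t)∕weight_k`. [folklore] -/
theorem apply_eq_sum_boxWave_of_eigen (B : Matrix (KingBox n) (KingBox n) ℝ) (σ : KingBox n → ℝ) (hB : ∀ k, B *ᵥ boxWave n k = σ k • boxWave n k)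
    (s t : KingBox n) : B s t = ∑ k : KingBox n, σ k * boxWave n k s * boxWave n k t / boxWaveWeight n k := by
  have h := eq_mul_diagonal_mul_transpose_of_boxWave_eigen n B σ hB
  have hst : B s t = (boxWaveMatrix n * Matrix.diagonal (fun k => σ k * (boxWaveWeight n k)⁻¹) * (boxWaveMatrix n)ᵀ) s t := by rw [← h]
  rw [hst, Matrix.mul_apply]
  refine Finset.sum_congr rfl fun k _ => ?_
  rw [Matrix.mul_diagonal, Matrix.transpose_apply]
  simp only [boxWaveMatrix]
  ring

/-- ★★ **SPECTRAL EXPANSION OF THE INVERSE**: `B⁻¹(s,t) = Σ_k w_k(s)w_k(t)∕(σ_k·weight_k)` (all `σ_k ≠ 0`). [folklore] -/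
theorem inv_apply_eq_sum_boxWave_of_eigen (B : Matrix (KingBox n) (KingBox n) ℝ) (σ : KingBox n → ℝ) (hB : ∀ k, B *ᵥ boxWave n k = σ k • boxWave n k)
    (hσ : ∀ k, σ k ≠ 0) (s t : KingBox n) : B⁻¹ s t = ∑ k : KingBox n, boxWave n k s * boxWave n k t / (σ k * boxWaveWeight n k) := by
  rw [apply_eq_sum_boxWave_of_eigen n B⁻¹ (fun k => (σ k)⁻¹) (inv_mulVec_boxWave_of_eigen n B σ hB hσ) s t]
  refine Finset.sum_congr rfl fun k _ => ?_
  field_simp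

end Generic

/-! ## §1 King's `c(−Δ)+m²` with free boundary conditions on `Ω` -/

section FreeOperator

variable (n : Fin (d + 1) → ℕ) [hn : ∀ μ, NeZero (n μ)]

/-- the plane-wave eigen-equation of `lapF` on any torus: `Σ_y B(x,y)e^{iq·y} = lapSym(q)e^{iq·x}` (Ε-e `sum_lapF_mul_chi` at base point `0`). [cite: King1986, (4.4) p.670] -/
theorem lapF_eigen_chi (K : Fin (d + 1) → ℕ) [∀ μ, NeZero (K μ)] (c m2 : ℝ) (q x : Tor K) :
    ∑ y, (lapF K c m2 x y : ℂ) * chi K q y = (lapSym K c m2 q : ℂ) * chi K q x := by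
  have h := sum_lapF_mul_chi K c m2 q x 0
  simp only [sub_zero] at h
  exact h

omit hn in
/-- the centred residue of the half-grid momentum: `valMinAbs(k̂_μ) = k_μ` (`0 ≤ k_μ < n_μ = (2n_μ)∕2`). [folklore] -/
theorem valMinAbs_dblBox (k : KingBox n) (μ : Fin (d + 1)) : ((dblBox n k μ).valMinAbs : ℤ) = (k μ).val := by
  show ((((k μ).val : ℕ) : ZMod (2 * n μ)).valMinAbs : ℤ) = (k μ).val
  rw [ZMod.valMinAbs_natCast_of_le_half]
  rw [Nat.mul_div_cancel_left _ (by norm_num : 0 < 2)]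
  exact (k μ).isLt.le

omit hn in
/-- ★ **THE REDUCED MOMENTUM OF `k̂` IS `πk_μ∕n_μ ∈ [0, π)`.** [cite: King1986, (4.1) p.670] -/
theorem sOf_dblBox (k : KingBox n) (μ : Fin (d + 1)) : sOf (dblPer n) (dblBox n k) μ = Real.pi * (k μ).val / n μ := by
  unfold sOf
  rw [show ((dblBox n k μ).valMinAbs : ℝ) = (((dblBox n k μ).valMinAbs : ℤ) : ℝ) from rfl, valMinAbs_dblBox]
  simp only [dblPer]
  push_cast
  rw [mul_assoc, mul_div_mul_left _ _ (two_ne_zero' ℝ)]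

omit hn in
/-- ★ **THE NEUMANN EIGENVALUE**: `lapSym(2n)(k̂) = m² + cΣ_μ(2 − 2cos(πk_μ∕n_μ))`. [cite: King1986, (4.4) p.670, §4 p.670] -/
theorem lapSym_dblBox (c m2 : ℝ) (k : KingBox n) :
    lapSym (dblPer n) c m2 (dblBox n k) = m2 + c * ∑ μ, (2 - 2 * Real.cos (Real.pi * (k μ).val / n μ)) := by
  unfold lapSym
  simp_rw [sOf_dblBox]

/-- ★★★ **THE NEUMANN EIGEN-EQUATION ON KING's REGION**: `(c(−Δ_free)+m²)·w_k = (m² + cΣ_μ(2−2cos(πk_μ∕n_μ)))·w_k` for every `k ∈ Ω` and all real `c, m²` — the cosine waves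
diagonalise King's operator «(2.13) with free boundary conditions». [cite: King1986, §4 p.670 l.8–13, (2.13) p.653, (4.4) p.670] -/
theorem boxOp_mulVec_boxWave (c m2 : ℝ) (k : KingBox n) : boxOp n c m2 *ᵥ boxWave n k = lapSym (dblPer n) c m2 (dblBox n k) • boxWave n k := by
  rw [boxOp_eq_foldOp]
  exact foldOp_mulVec_boxWave n (isReflSymm_lapF n c m2) k fun x => lapF_eigen_chi (dblPer n) c m2 (dblBox n k) x

/-- ★★★ **THE FREE DETERMINANT WITH FREE BOUNDARY CONDITIONS**: `det(c(−Δ_free)+m²)_Ω = Π_{k∈Ω} lapSym(2n)(k̂)` on every box, all real `c, m²`.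
[cite: King1986, §4 p.670 l.8–13, (3.89) p.668, (4.4) p.670] -/
theorem det_boxOp_eq_prod_lapSym (c m2 : ℝ) : (boxOp n c m2).det = ∏ k : KingBox n, lapSym (dblPer n) c m2 (dblBox n k) :=
  det_eq_prod_of_boxWave_eigen n _ _ (boxOp_mulVec_boxWave n c m2)

/-- ★★ in cosines: `det(c(−Δ_free)+m²)_Ω = Π_{k∈Ω}(m² + cΣ_μ(2−2cos(πk_μ∕n_μ)))`. [cite: King1986, §4 p.670, (4.4) p.670] -/
theorem det_boxOp_eq_prod_cos (c m2 : ℝ) : (boxOp n c m2).det = ∏ k : KingBox n, (m2 + c * ∑ μ, (2 - 2 * Real.cos (Real.pi * (k μ).val / n μ))) := by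
  rw [det_boxOp_eq_prod_lapSym]
  exact Finset.prod_congr rfl fun k _ => lapSym_dblBox n c m2 k

/-- ★★ `tr(c(−Δ_free)+m²)_Ω = Σ_{k∈Ω} lapSym(2n)(k̂)`. [cite: King1986, §4 p.670, (4.4) p.670] -/
theorem trace_boxOp_eq_sum (c m2 : ℝ) : (boxOp n c m2).trace = ∑ k : KingBox n, lapSym (dblPer n) c m2 (dblBox n k) :=
  trace_eq_sum_of_boxWave_eigen n _ _ (boxOp_mulVec_boxWave n c m2)

variable {c m2 : ℝ}

/-- `det(c(−Δ_free)+m²)_Ω > 0` (`c ≥ 0`, `m² > 0`). [cite: King1986, (2.13) p.653, §4 p.670] -/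
theorem det_boxOp_pos (hc : 0 ≤ c) (hm : 0 < m2) : 0 < (boxOp n c m2).det := by
  rw [det_boxOp_eq_prod_lapSym]
  exact Finset.prod_pos fun k _ => lt_of_lt_of_le hm (lapSym_ge (dblPer n) c m2 hc _)

/-- ★★ `ln det(c(−Δ_free)+m²)_Ω = Σ_{k∈Ω} ln lapSym(2n)(k̂)`. [cite: King1986, (3.89) p.668, §4 p.670] -/
theorem log_det_boxOp (hc : 0 ≤ c) (hm : 0 < m2) : Real.log (boxOp n c m2).det = ∑ k : KingBox n, Real.log (lapSym (dblPer n) c m2 (dblBox n k)) := by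
  rw [det_boxOp_eq_prod_lapSym, Real.log_prod]
  exact fun k _ => (lt_of_lt_of_le hm (lapSym_ge (dblPer n) c m2 hc _)).ne'

/-- ★★ **VOLUME-UNIFORM BOUNDS, THE SAME AS ON THE TORUS**: `|Ω|·ln m² ≤ ln det(c(−Δ_free)+m²)_Ω ≤ |Ω|·ln(m² + 4c(d+1))`. [cite: King1986, (3.89)–(3.93) pp.668–669, §4 p.670] -/
theorem log_det_boxOp_bounds (hc : 0 ≤ c) (hm : 0 < m2) :
    (Fintype.card (KingBox n) : ℝ) * Real.log m2 ≤ Real.log (boxOp n c m2).det ∧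
      Real.log (boxOp n c m2).det ≤ (Fintype.card (KingBox n) : ℝ) * Real.log (m2 + 4 * c * (d + 1)) := by
  rw [log_det_boxOp n hc hm]
  constructor
  · calc (Fintype.card (KingBox n) : ℝ) * Real.log m2 = ∑ _k : KingBox n, Real.log m2 := by rw [Finset.sum_const, Finset.card_univ, nsmul_eq_mul]
      _ ≤ _ := Finset.sum_le_sum fun k _ => Real.log_le_log hm (lapSym_ge (dblPer n) c m2 hc _)
  · calc ∑ k : KingBox n, Real.log (lapSym (dblPer n) c m2 (dblBox n k)) ≤ ∑ _k : KingBox n, Real.log (m2 + 4 * c * (d + 1)) :=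
          Finset.sum_le_sum fun k _ => Real.log_le_log (lt_of_lt_of_le hm (lapSym_ge (dblPer n) c m2 hc _)) (lapSym_le (dblPer n) hc m2 _)
      _ = _ := by rw [Finset.sum_const, Finset.card_univ, nsmul_eq_mul]

/-- ★★ **THE FREE-FIELD NORMALISATION WITH FREE BOUNDARY CONDITIONS**: `ln 𝒩((c(−Δ_free)+m²)_Ω) = ½|Ω|·ln 2π − ½Σ_{k∈Ω} ln lapSym(2n)(k̂)` (part Τ-b's `gaussNorm`, Ε-p's
determinant formula; `c ≥ 0`, `m² > 0`). [cite: King1986, (3.89) p.668, (2.6) p.652, §4 p.670] -/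
theorem log_gaussNorm_boxOp (hc : 0 ≤ c) (hm : 0 < m2) :
    Real.log (gaussNorm (boxOp n c m2)) = (Fintype.card (KingBox n) : ℝ) / 2 * Real.log (2 * Real.pi) - 1 / 2 * ∑ k : KingBox n, Real.log (lapSym (dblPer n) c m2 (dblBox n k)) := by
  rw [log_gaussNorm_eq (boxOp_transpose n hc hm) hm (boxOp_coercive n hc m2), log_det_boxOp n hc hm]

/-- the Neumann Green's function on the cosine waves: `(c(−Δ_free)+m²)_Ω⁻¹w_k = lapSym(2n)(k̂)⁻¹w_k`. [cite: King1986, (2.17) p.653, §4 p.670] -/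
theorem boxOp_inv_mulVec_boxWave (hc : 0 ≤ c) (hm : 0 < m2) (k : KingBox n) :
    (boxOp n c m2)⁻¹ *ᵥ boxWave n k = (lapSym (dblPer n) c m2 (dblBox n k))⁻¹ • boxWave n k :=
  inv_mulVec_boxWave_of_eigen n _ _ (boxOp_mulVec_boxWave n c m2) (fun _ => (lt_of_lt_of_le hm (lapSym_ge (dblPer n) c m2 hc _)).ne') k

/-- ★★★ **THE NEUMANN GREEN's FUNCTION OF KING's REGION IN THE COSINE BASIS**: `G^Ω(s,t) = Σ_{k∈Ω} w_k(s)w_k(t)∕(weight_k·lapSym(2n)(k̂))` (`c ≥ 0`, `m² > 0`) — a closed form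
next to the image sum (Ν-a′) and [Ba 4] (2.42)'s series (Ε-c). [cite: King1986, (2.17) p.653, §4 p.670 l.8–13; Balaban1983RegularityDecay, (2.42) p.584] -/
theorem kingBoxGreen_eq_sum_boxWave (hc : 0 ≤ c) (hm : 0 < m2) (s t : KingBox n) :
    kingBoxGreen n c m2 s t = ∑ k : KingBox n, boxWave n k s * boxWave n k t / (lapSym (dblPer n) c m2 (dblBox n k) * boxWaveWeight n k) := by
  rw [← boxOp_inv_eq_kingBoxGreen n hc hm]
  exact inv_apply_eq_sum_boxWave_of_eigen n _ _ (boxOp_mulVec_boxWave n c m2) (fun _ => (lt_of_lt_of_le hm (lapSym_ge (dblPer n) c m2 hc _)).ne') s t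

end FreeOperator

/-! ## §2 King's RG block-field operator `Δ^{(K)}` on `Ω` with free boundary conditions -/

section BlockField

variable (N : ℕ) [NeZero N] (n : Fin (d + 1) → ℕ) [hn : ∀ μ, NeZero (n μ)] {a c m2 : ℝ}

/-- ★★ the cosine waves diagonalise `Δ^{(K)}_Ω = fold(Δ^{(K)})`: `Δ^{(K)}_Ω w_k = effSym(k̂) w_k` (`a, c ≥ 0`, `m² > 0`). [cite: King1986, (2.14) p.653, (4.5) p.670, §4 p.670] -/
theorem foldOp_effLaplacian_mulVec_boxWave (ha : 0 ≤ a) (hc : 0 ≤ c) (hm : 0 < m2) (k : KingBox n) :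
    foldOp n (effLaplacian N (dblPer n) a c m2) *ᵥ boxWave n k = effSym N (dblPer n) a c m2 (dblBox n k) • boxWave n k :=
  foldOp_mulVec_boxWave_of_fourierForm n _ (isReflSymm_effLaplacian N n a c m2) _ (effSym_neg N (dblPer n) a c m2)
    (effLaplacian_apply_eq_fourier N (dblPer n) ha hc hm) k

/-- ★★★ **THE RG BLOCK-FIELD DETERMINANT ON KING's REGION**: `det Δ^{(K)}_Ω = Π_{k∈Ω} effSym(k̂)` (every `N ≥ 1`, `a, c ≥ 0`, `m² > 0`, every box of blocks).
[cite: King1986, (2.14) p.653, (3.89) p.668, (4.5) p.670, §4 p.670 l.8–13] -/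
theorem det_foldOp_effLaplacian_eq_prod (ha : 0 ≤ a) (hc : 0 ≤ c) (hm : 0 < m2) :
    (foldOp n (effLaplacian N (dblPer n) a c m2)).det = ∏ k : KingBox n, effSym N (dblPer n) a c m2 (dblBox n k) :=
  det_eq_prod_of_boxWave_eigen n _ _ (foldOp_effLaplacian_mulVec_boxWave N n ha hc hm)

/-- `tr Δ^{(K)}_Ω = Σ_{k∈Ω} effSym(k̂)`. [cite: King1986, (2.14) p.653, (4.5) p.670] -/
theorem trace_foldOp_effLaplacian_eq_sum (ha : 0 ≤ a) (hc : 0 ≤ c) (hm : 0 < m2) :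
    (foldOp n (effLaplacian N (dblPer n) a c m2)).trace = ∑ k : KingBox n, effSym N (dblPer n) a c m2 (dblBox n k) :=
  trace_eq_sum_of_boxWave_eigen n _ _ (foldOp_effLaplacian_mulVec_boxWave N n ha hc hm)

/-- `det Δ^{(K)}_Ω > 0` (`a > 0`). [cite: King1986, (2.14) p.653, (4.8) p.671] -/
theorem det_foldOp_effLaplacian_pos (ha : 0 < a) (hc : 0 ≤ c) (hm : 0 < m2) : 0 < (foldOp n (effLaplacian N (dblPer n) a c m2)).det := by
  rw [det_foldOp_effLaplacian_eq_prod N n ha.le hc hm]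
  exact Finset.prod_pos fun k _ => effSym_pos' N (dblPer n) ha hc hm _

/-- ★★ `ln det Δ^{(K)}_Ω = Σ_{k∈Ω} ln effSym(k̂)`. [cite: King1986, (3.89) p.668, (4.5) p.670] -/
theorem log_det_foldOp_effLaplacian (ha : 0 < a) (hc : 0 ≤ c) (hm : 0 < m2) :
    Real.log (foldOp n (effLaplacian N (dblPer n) a c m2)).det = ∑ k : KingBox n, Real.log (effSym N (dblPer n) a c m2 (dblBox n k)) := by
  rw [det_foldOp_effLaplacian_eq_prod N n ha.le hc hm, Real.log_prod]
  exact fun k _ => (effSym_pos' N (dblPer n) ha hc hm _).ne'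

/-- ★★ **VOLUME-UNIFORM BOUNDS**: `|Ω|·ln(a∕(1+a∕m²)) ≤ ln det Δ^{(K)}_Ω ≤ |Ω|·ln a`. [cite: King1986, (3.89)–(3.93) pp.668–669, (4.5) p.670, (4.8) p.671] -/
theorem log_det_foldOp_effLaplacian_bounds (ha : 0 < a) (hc : 0 ≤ c) (hm : 0 < m2) :
    (Fintype.card (KingBox n) : ℝ) * Real.log (a / (1 + a / m2)) ≤ Real.log (foldOp n (effLaplacian N (dblPer n) a c m2)).det ∧
      Real.log (foldOp n (effLaplacian N (dblPer n) a c m2)).det ≤ (Fintype.card (KingBox n) : ℝ) * Real.log a := by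
  rw [log_det_foldOp_effLaplacian N n ha hc hm]
  have hlow : 0 < a / (1 + a / m2) := by positivity
  constructor
  · calc (Fintype.card (KingBox n) : ℝ) * Real.log (a / (1 + a / m2)) = ∑ _k : KingBox n, Real.log (a / (1 + a / m2)) := by
          rw [Finset.sum_const, Finset.card_univ, nsmul_eq_mul]
      _ ≤ _ := Finset.sum_le_sum fun k _ => Real.log_le_log hlow (effSym_bounds N (dblPer n) ha hc hm _).1
  · calc ∑ k : KingBox n, Real.log (effSym N (dblPer n) a c m2 (dblBox n k)) ≤ ∑ _k : KingBox n, Real.log a :=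
          Finset.sum_le_sum fun k _ => Real.log_le_log (effSym_pos' N (dblPer n) ha hc hm _) (effSym_bounds N (dblPer n) ha hc hm _).2
      _ = _ := by rw [Finset.sum_const, Finset.card_univ, nsmul_eq_mul]

/-- ★★★ **KING's (3.89) ON `Ω` LITERALLY — THE BLOCK-FIELD NORMALISATION WITH FREE BOUNDARY CONDITIONS**: `ln N_K(Ω) := ln 𝒩(Δ^{(K)}_Ω) = ½|Ω|·ln 2π − ½Σ_{k∈Ω} ln effSym(k̂)`
(every `N ≥ 1`, `a > 0`, `c ≥ 0`, `m² > 0`, every box of blocks; `Δ^{(K)}_Ω = fold(Δ^{(K)})` of part Ν-g, its Gaussian law = King's `dμ^{(K)}_Ω` of part Ν-h).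
[cite: King1986, (3.89) p.668, (2.6) p.652, (2.14)–(2.15) p.653, (4.5) p.670, §4 p.670 l.8–13] -/
theorem log_gaussNorm_foldOp_effLaplacian (ha : 0 < a) (hc : 0 ≤ c) (hm : 0 < m2) :
    Real.log (gaussNorm (foldOp n (effLaplacian N (dblPer n) a c m2)))
      = (Fintype.card (KingBox n) : ℝ) / 2 * Real.log (2 * Real.pi) - 1 / 2 * ∑ k : KingBox n, Real.log (effSym N (dblPer n) a c m2 (dblBox n k)) := by
  rw [log_gaussNorm_eq (foldOp_transpose_eq n (isReflSymm_effLaplacian N n a c m2) (effLaplacian_transpose_eq N (dblPer n) a c m2))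
      (by positivity : (0 : ℝ) < (a⁻¹ + m2⁻¹)⁻¹) (foldOp_effLaplacian_coercive N n ha hc hm), log_det_foldOp_effLaplacian N n ha hc hm]

/-- ★★ **VOLUME-UNIFORM BOUNDS FOR `ln N_K(Ω)`**: `½|Ω|(ln 2π − ln a) ≤ ln N_K(Ω) ≤ ½|Ω|(ln 2π − ln(a∕(1+a∕m²)))`. [cite: King1986, (3.89)–(3.93) pp.668–669] -/
theorem log_gaussNorm_foldOp_effLaplacian_bounds (ha : 0 < a) (hc : 0 ≤ c) (hm : 0 < m2) :
    (Fintype.card (KingBox n) : ℝ) / 2 * (Real.log (2 * Real.pi) - Real.log a) ≤ Real.log (gaussNorm (foldOp n (effLaplacian N (dblPer n) a c m2))) ∧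
      Real.log (gaussNorm (foldOp n (effLaplacian N (dblPer n) a c m2))) ≤ (Fintype.card (KingBox n) : ℝ) / 2 * (Real.log (2 * Real.pi) - Real.log (a / (1 + a / m2))) := by
  rw [log_gaussNorm_foldOp_effLaplacian N n ha hc hm, ← log_det_foldOp_effLaplacian N n ha hc hm]
  obtain ⟨h1, h2⟩ := log_det_foldOp_effLaplacian_bounds N n ha hc hm
  constructor <;> nlinarith

/-- `(Δ^{(K)}_Ω)⁻¹` on the cosine waves: `(Δ^{(K)}_Ω)⁻¹w_k = effSym(k̂)⁻¹w_k`. [cite: King1986, (2.14) p.653, (4.5) p.670] -/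
theorem foldOp_effLaplacian_inv_mulVec_boxWave (ha : 0 < a) (hc : 0 ≤ c) (hm : 0 < m2) (k : KingBox n) :
    (foldOp n (effLaplacian N (dblPer n) a c m2))⁻¹ *ᵥ boxWave n k = (effSym N (dblPer n) a c m2 (dblBox n k))⁻¹ • boxWave n k :=
  inv_mulVec_boxWave_of_eigen n _ _ (foldOp_effLaplacian_mulVec_boxWave N n ha.le hc hm) (fun _ => (effSym_pos' N (dblPer n) ha hc hm _).ne') k

/-- ★★★ **NE2's UNIT-LAYER KERNEL ON KING's REGION IN THE COSINE BASIS**: `(Δ^{(K)}_Ω)⁻¹(s,t) = Σ_{k∈Ω} w_k(s)w_k(t)∕(weight_k·effSym(k̂))` (`a > 0`, `c ≥ 0`, `m² > 0`) — the RG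
block-field covariance with free boundary conditions (part Ν-g: `= fold((Δ^{(K)})⁻¹)`, the image sum of the torus covariance) as a cosine series. [cite: King1986, (2.14) p.653,
(4.5) p.670, §4 p.670 l.8–13] -/
theorem foldOp_effLaplacian_inv_apply_eq_sum_boxWave (ha : 0 < a) (hc : 0 ≤ c) (hm : 0 < m2) (s t : KingBox n) :
    (foldOp n (effLaplacian N (dblPer n) a c m2))⁻¹ s t
      = ∑ k : KingBox n, boxWave n k s * boxWave n k t / (effSym N (dblPer n) a c m2 (dblBox n k) * boxWaveWeight n k) :=
  inv_apply_eq_sum_boxWave_of_eigen n _ _ (foldOp_effLaplacian_mulVec_boxWave N n ha.le hc hm) (fun _ => (effSym_pos' N (dblPer n) ha hc hm _).ne') s t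

end BlockField

end Summit.QuantumFields.YangMills.BalabanUVNodes.N15KingModelRung.TorusSpectral

end
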